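import Literature.MathematicalPhysics.QuantumLattice.TIDensityPhaseCoexistence
import Literature.MathematicalPhysics.QuantumLattice.TIGroundEnergyDensityConservedDensities
import HarnessLib

/-!
# The FIELD axis of the model-free coexistence laws: for ANY lattice-fermion interaction `Ψ` the Zeeman pencil `Ψ − h·(n↑−n↓)`
# has fixed-filling energies / canonical pressures within `|h|·min(ρ, 2−ρ)` (resp. `β|h|·min(ρ,2−ρ)`) of those of `Ψ`, so every
# zero-field phase-separation exclusion for `Ψ` is one in the field, with margin `M ↦ M − |h|·(m̄(n̄) + a m̄(n₁) + b m̄(n₂))`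

Topic `Literature/MathematicalPhysics/QuantumLattice` (general `d`; any `Ψ : FermionInteraction d`, any range `R`; the field interaction is the
tree's pencil `FermionInteraction.pencil Ψ (spinImbalanceInteraction d) (−h)`, mean energy `e_Ψ(ω) − h·m(ω)`). Sequel of
`TIDensityPhaseCoexistence` (model-free `T = 0` / `T ≥ 0` single-density coexistence laws) and the model-free twin of
`HubbardTTPrimePhaseCoexistenceExclusionZeeman` (which for the 2D `t–t'` model uses the SHARPER spin-symmetric windows `E_h ≤ e`,
`p ≤ p_h` at the mean density — here no symmetry of `Ψ` is assumed, so the mean density also pays `|h|·m̄(n̄)`). PROVED: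

* §1 FIELD WINDOWS, model-free (realised density `ρ`, `m̄(ρ) = min(ρ, 2−ρ) ≥ |m(ω)|` for every state of density `ρ`,
  `meanEnergy_spinImbalance_mem_Icc`):
  `e_ρ(Ψ) − |h|·m̄(ρ) ≤ e_ρ(Ψ − h m) ≤ e_ρ(Ψ) + |h|·m̄(ρ)` and, for `β ≥ 0`,
  `P(β,Ψ;ρ) − β|h|·m̄(ρ) ≤ P(β,Ψ − h m;ρ) ≤ P(β,Ψ;ρ) + β|h|·m̄(ρ)`.
* §2 `T = 0` FIELD LAW (`fieldPencilGroundEnergy_lt_meanEnergy_mix_of_cap_lt_floors_of_le`): zero-field cap `e_{an₁+bn₂}(Ψ) ≤ c` and floors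
  `f_i ≤ e_{n_i}(Ψ)` with `c + |h|·(m̄(an₁+bn₂) + a m̄(n₁) + b m̄(n₂)) < a f₁ + b f₂` exclude, for the FIELD interaction, every macroscopic mixture
  of translation-invariant states with densities `ρ(ω₁) ≤ n₁ < n₂ ≤ ρ(ω₂)` from being a ground state at its filling.
* §3 `T ≥ 0` FIELD LAW (`sub_mul_fieldPencil_lt_varPressureAt_mix_of_caps_lt_floor_of_le`, `d ≥ 1`, `β ≥ 0`): zero-field pressure floor
  `W ≤ P(β,Ψ; an₁+bn₂)`, caps `P(β,Ψ;n_i) ≤ Q_i` with `aQ₁ + bQ₂ + β|h|·(m̄(n̄) + a m̄(n₁) + b m̄(n₂)) < W` exclude the coexistence among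
  canonical equilibrium states of the field interaction.

USE (instances under `Summits/…`): `Ψ` = the 3D layered `t–t'` crystal, whose zero-field numbers sit in the 2D windows
(`HubbardTTPrimePhaseCoexistenceExclusionLayered`) ⇒ the JOINT `(T, H, t_z)` budget of the competing-orders word: margin
`M ↦ M − (4/π)Σ|t_z| − |h|·(m̄(n̄) + a m̄₁ + b m̄₂)`.
HONEST SCOPE: Zeeman coupling to `N↑ − N↓` only; statements about translation-invariant states and two-component convex decompositions;
everything is PROVED; no definition, no named fact, no number. Written 2026-08-28 by hubbard-downfold-unc-2 (g21; cell `pub/hubbard-downfold`,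
MO-S1 ↔ S2 seam, filling direction — `h` and `m` are the spin twin of the Legendre pair `(μ, n)`).

## Mathlib / tree search
REUSED: `FermionInteraction.pencil`, `InfVolFermionState.meanEnergy_pencil` (`TIGroundEnergyDensityResponse`); `spinImbalanceInteraction`,
`InfVolFermionState.meanEnergy_spinImbalance_mem_Icc` (`TIGroundEnergyDensityConservedDensities`); `le_tiGroundEnergyDensityAt`,
`tiGroundEnergyDensityAt_le_meanEnergy`, `varPressureAt_le`, `sub_mul_le_varPressureAt`; the laws of `TIDensityPhaseCoexistence`.
`lean search 'pencil.*spinImbalance|tiGroundEnergyDensityAt.*field'` (2026-08-28): only the `t–t'`-specific `HubbardTTPrimeGroundEnergyZeeman`.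

## References
* R. B. Griffiths, J. Math. Phys. 5 (1964) 1215, Appendix (convexity in the field). [cite: Griffiths1964, Appendix]
* R. B. Israel, *Convexity in the Theory of Lattice Gases* (1979), Thm. I.2.4. [cite: Israel1979, Thm. I.2.4]
* D. Ruelle, *Statistical Mechanics: Rigorous Results* (1969), §3.4. [cite: Ruelle1969, §3.4]
-/

noncomputable section

open scoped ComplexOrder BigOperators

namespace Literature.MathematicalPhysics.QuantumLattice

open InfVolFermionState FermionInteraction Set

/-! ## §1 Model-free field windows at fixed density -/

namespace FermionInteraction

variable {d : ℕ} (Ψ : FermionInteraction d) (R : ℝ) (hz : ℝ)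

/-- Pointwise: `|h·m(ω)| ≤ |h|·min(ρ, 2−ρ)` for a state of density `ρ`. [cite: Griffiths1964, Appendix] -/
private theorem field_term_abs_le (ω : InfVolFermionState d) {ρ : ℝ} (hρ : ω.density = ρ) :
    |hz * ω.meanEnergy (spinImbalanceInteraction d) R| ≤ |hz| * min ρ (2 - ρ) := by
  obtain ⟨h1, h2⟩ := ω.meanEnergy_spinImbalance_mem_Icc hρ R
  rw [abs_mul]
  exact mul_le_mul_of_nonneg_left (abs_le.2 ⟨h1, h2⟩) (abs_nonneg _)

/-- **`T = 0` field window, lower edge (model-free)**: `e_ρ(Ψ) − |h|·min(ρ,2−ρ) ≤ e_ρ(Ψ − h m)` for every realised density `ρ`.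
[cite: Griffiths1964, Appendix] [cite: Ruelle1969, §3.4] -/
theorem tiGroundEnergyDensityAt_sub_field_le_pencil {ρ : ℝ}
    (hne : ∃ ω : InfVolFermionState d, ω.IsTranslationInvariant ∧ ω.density = ρ) :
    Ψ.tiGroundEnergyDensityAt R ρ - |hz| * min ρ (2 - ρ) ≤
      (pencil Ψ (spinImbalanceInteraction d) (-hz)).tiGroundEnergyDensityAt R ρ := by
  refine (pencil Ψ (spinImbalanceInteraction d) (-hz)).le_tiGroundEnergyDensityAt R hne fun ω hω hρ => ?_
  have h1 := Ψ.tiGroundEnergyDensityAt_le_meanEnergy R hω hρ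
  have h2 := (abs_le.1 (field_term_abs_le R hz ω hρ)).2
  rw [ω.meanEnergy_pencil]
  nlinarith

/-- **`T = 0` field window, upper edge (model-free)**: `e_ρ(Ψ − h m) ≤ e_ρ(Ψ) + |h|·min(ρ,2−ρ)`. [cite: Griffiths1964, Appendix] -/
theorem tiGroundEnergyDensityAt_pencil_le_add_field {ρ : ℝ}
    (hne : ∃ ω : InfVolFermionState d, ω.IsTranslationInvariant ∧ ω.density = ρ) :
    (pencil Ψ (spinImbalanceInteraction d) (-hz)).tiGroundEnergyDensityAt R ρ ≤
      Ψ.tiGroundEnergyDensityAt R ρ + |hz| * min ρ (2 - ρ) := by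
  have key : (pencil Ψ (spinImbalanceInteraction d) (-hz)).tiGroundEnergyDensityAt R ρ - |hz| * min ρ (2 - ρ) ≤
      Ψ.tiGroundEnergyDensityAt R ρ := by
    refine Ψ.le_tiGroundEnergyDensityAt R hne fun ω hω hρ => ?_
    have h1 := (pencil Ψ (spinImbalanceInteraction d) (-hz)).tiGroundEnergyDensityAt_le_meanEnergy R hω hρ
    have h2 := (abs_le.1 (field_term_abs_le R hz ω hρ)).1
    rw [ω.meanEnergy_pencil] at h1
    nlinarith
  linarith

/-- **`T ≥ 0` field window, lower edge (model-free)**: `P(β,Ψ;ρ) − β|h|·min(ρ,2−ρ) ≤ P(β,Ψ − h m;ρ)` (`β ≥ 0`, realised `ρ`).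
[cite: Griffiths1964, Appendix] [cite: Israel1979, Thm. I.2.4] -/
theorem varPressureAt_sub_field_le_pencil {β : ℝ} (hβ : 0 ≤ β) {ρ : ℝ}
    (hne : ∃ ω : InfVolFermionState d, ω.IsTranslationInvariant ∧ ω.density = ρ) :
    Ψ.varPressureAt β R ρ - β * |hz| * min ρ (2 - ρ) ≤ (pencil Ψ (spinImbalanceInteraction d) (-hz)).varPressureAt β R ρ := by
  have key : Ψ.varPressureAt β R ρ ≤ (pencil Ψ (spinImbalanceInteraction d) (-hz)).varPressureAt β R ρ + β * |hz| * min ρ (2 - ρ) := by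
    refine Ψ.varPressureAt_le β R ρ hne fun ω hω hρ => ?_
    have h1 := (pencil Ψ (spinImbalanceInteraction d) (-hz)).sub_mul_le_varPressureAt β R ρ hω hρ
    have h2 := (abs_le.1 (field_term_abs_le R hz ω hρ)).1
    rw [ω.meanEnergy_pencil] at h1
    have h3 : β * (-hz * ω.meanEnergy (spinImbalanceInteraction d) R) ≤ β * (|hz| * min ρ (2 - ρ)) :=
      mul_le_mul_of_nonneg_left (by linarith) hβ
    nlinarith
  linarith

/-- **`T ≥ 0` field window, upper edge (model-free)**: `P(β,Ψ − h m;ρ) ≤ P(β,Ψ;ρ) + β|h|·min(ρ,2−ρ)`. [cite: Griffiths1964, Appendix] -/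
theorem varPressureAt_pencil_le_add_field {β : ℝ} (hβ : 0 ≤ β) {ρ : ℝ}
    (hne : ∃ ω : InfVolFermionState d, ω.IsTranslationInvariant ∧ ω.density = ρ) :
    (pencil Ψ (spinImbalanceInteraction d) (-hz)).varPressureAt β R ρ ≤ Ψ.varPressureAt β R ρ + β * |hz| * min ρ (2 - ρ) := by
  refine (pencil Ψ (spinImbalanceInteraction d) (-hz)).varPressureAt_le β R ρ hne fun ω hω hρ => ?_
  have h1 := Ψ.sub_mul_le_varPressureAt β R ρ hω hρ
  have h2 := (abs_le.1 (field_term_abs_le R hz ω hρ)).2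
  rw [ω.meanEnergy_pencil]
  have h3 : β * (-(-hz * ω.meanEnergy (spinImbalanceInteraction d) R)) ≤ β * (|hz| * min ρ (2 - ρ)) :=
    mul_le_mul_of_nonneg_left (by linarith) hβ
  nlinarith

end FermionInteraction

/-! ## §2 `T = 0`: field ground states of `Ψ − h m`, from zero-field windows of `Ψ` -/

namespace InfVolFermionState

variable {d : ℕ} (Ψ : FermionInteraction d) (R : ℝ) (hz : ℝ) {ω₁ ω₂ : InfVolFermionState d}

/-- Weights: `a n₁ + b n₂ ∈ [n₁, n₂]` for `a, b ≥ 0`, `a + b = 1`, `n₁ ≤ n₂`. [folklore] -/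
private theorem convexComb_mem_Icc'' {a b n₁ n₂ : ℝ} (ha : 0 ≤ a) (hb : 0 ≤ b) (hab : a + b = 1) (h : n₁ ≤ n₂) :
    n₁ ≤ a * n₁ + b * n₂ ∧ a * n₁ + b * n₂ ≤ n₂ := by
  have e1 : a * n₁ + b * n₂ = n₁ + b * (n₂ - n₁) := by
    have ha' : a = 1 - b := by linarith
    rw [ha']; ring
  have e2 : a * n₁ + b * n₂ = n₂ - a * (n₂ - n₁) := by
    have hb' : b = 1 - a := by linarith
    rw [hb']; ring
  constructor
  · rw [e1]; nlinarith [mul_nonneg hb (sub_nonneg.2 h)]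
  · rw [e2]; nlinarith [mul_nonneg ha (sub_nonneg.2 h)]

/-- **Model-free `T = 0` competing-orders law in a Zeeman field.** Translation-invariant `ω₁, ω₂` with
`ρ(ω₁) ≤ n₁ < n₂ ≤ ρ(ω₂)`; weights `a, b ≥ 0`, `a + b = 1`, `n̄ = an₁ + bn₂`; ZERO-FIELD data for `Ψ`: a cap `e_{n̄}(Ψ) ≤ c` and floors
`f_i ≤ e_{n_i}(Ψ)` with `c + |h|·(m̄(n̄) + a m̄(n₁) + b m̄(n₂)) < a f₁ + b f₂` (`m̄(ρ) = min(ρ,2−ρ)`). Then for every `0 < λ < 1` the mixture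
`λω₁ + (1−λ)ω₂` is NOT a ground state of the field interaction `Ψ − h m` at its filling. [cite: Israel1979, Thm. I.2.4] [cite: Griffiths1964, Appendix] -/
theorem IsTranslationInvariant.fieldPencilGroundEnergy_lt_meanEnergy_mix_of_cap_lt_floors_of_le (h₁ : ω₁.IsTranslationInvariant)
    (h₂ : ω₂.IsTranslationInvariant) {n₁ n₂ : ℝ} (hn₁ : ω₁.density ≤ n₁) (hn12 : n₁ < n₂) (hn₂ : n₂ ≤ ω₂.density)
    {a b : ℝ} (ha : 0 ≤ a) (hb : 0 ≤ b) (hab : a + b = 1) {c f₁ f₂ : ℝ}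
    (hcap : Ψ.tiGroundEnergyDensityAt R (a * n₁ + b * n₂) ≤ c)
    (hf₁ : f₁ ≤ Ψ.tiGroundEnergyDensityAt R n₁) (hf₂ : f₂ ≤ Ψ.tiGroundEnergyDensityAt R n₂)
    (hM : c + |hz| * (min (a * n₁ + b * n₂) (2 - (a * n₁ + b * n₂)) + a * min n₁ (2 - n₁) + b * min n₂ (2 - n₂)) <
      a * f₁ + b * f₂)
    {lam : ℝ} (hl0 : 0 < lam) (hl1 : lam < 1) :
    (FermionInteraction.pencil Ψ (spinImbalanceInteraction d) (-hz)).tiGroundEnergyDensityAt R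
        (InfVolFermionState.mix lam hl0.le hl1.le ω₁ ω₂).density <
      (InfVolFermionState.mix lam hl0.le hl1.le ω₁ ω₂).meanEnergy (FermionInteraction.pencil Ψ (spinImbalanceInteraction d) (-hz)) R := by
  obtain ⟨hmlo, hmhi⟩ := convexComb_mem_Icc'' ha hb hab hn12.le
  have real : ∀ ρ, n₁ ≤ ρ → ρ ≤ n₂ → ∃ ω : InfVolFermionState d, ω.IsTranslationInvariant ∧ ω.density = ρ :=
    fun ρ hlo hhi => exists_isTranslationInvariant_density_eq_of_mem_Icc h₁ h₂ ⟨hn₁.trans hlo, hhi.trans hn₂⟩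
  have hcap' : (FermionInteraction.pencil Ψ (spinImbalanceInteraction d) (-hz)).tiGroundEnergyDensityAt R (a * n₁ + b * n₂) ≤
      c + |hz| * min (a * n₁ + b * n₂) (2 - (a * n₁ + b * n₂)) := by
    have h := Ψ.tiGroundEnergyDensityAt_pencil_le_add_field R hz (real _ hmlo hmhi)
    linarith
  have hf₁' := Ψ.tiGroundEnergyDensityAt_sub_field_le_pencil R hz (real n₁ le_rfl hn12.le)
  have hf₂' := Ψ.tiGroundEnergyDensityAt_sub_field_le_pencil R hz (real n₂ hn12.le le_rfl)
  refine h₁.tiGroundEnergyDensityAt_lt_meanEnergy_mix_of_cap_lt_floors_of_le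
    (FermionInteraction.pencil Ψ (spinImbalanceInteraction d) (-hz)) R h₂ hn₁ hn12 hn₂ ha hb hab hcap'
    (f₁ := f₁ - |hz| * min n₁ (2 - n₁)) (f₂ := f₂ - |hz| * min n₂ (2 - n₂)) (by linarith) (by linarith) ?_ hl0 hl1
  have e : a * (f₁ - |hz| * min n₁ (2 - n₁)) + b * (f₂ - |hz| * min n₂ (2 - n₂)) =
      a * f₁ + b * f₂ - |hz| * (a * min n₁ (2 - n₁) + b * min n₂ (2 - n₂)) := by ring
  rw [e]
  linarith

/-! ## §3 `T ≥ 0`: canonical field equilibrium states of `Ψ − h m`, from zero-field pressure windows of `Ψ` -/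

/-- **Model-free `T ≥ 0` competing-orders law in a Zeeman field** (`d ≥ 1`, `β ≥ 0`). Translation-invariant `ω₁, ω₂` with
`ρ(ω₁) ≤ n₁ < n₂ ≤ ρ(ω₂)`; weights `a + b = 1`, `n̄ = an₁ + bn₂`; ZERO-FIELD pressure data for `Ψ`: a floor `W ≤ P(β,Ψ;n̄)`, caps `P(β,Ψ;n_i) ≤ Q_i`
with `aQ₁ + bQ₂ + β|h|·(m̄(n̄) + a m̄(n₁) + b m̄(n₂)) < W`. Then for every `0 < λ < 1` the mixture is NOT a canonical equilibrium state of
`Ψ − h m`: `s̄(mix) − β e_{Ψ−hm}(mix) < P(β, Ψ − h m; ρ(mix))`. [cite: Israel1979, Thm. I.2.4] [cite: Griffiths1964, Appendix] -/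
theorem IsTranslationInvariant.sub_mul_fieldPencil_lt_varPressureAt_mix_of_caps_lt_floor_of_le (hd : 0 < d) {β : ℝ} (hβ : 0 ≤ β)
    (h₁ : ω₁.IsTranslationInvariant) (h₂ : ω₂.IsTranslationInvariant)
    {n₁ n₂ : ℝ} (hn₁ : ω₁.density ≤ n₁) (hn12 : n₁ < n₂) (hn₂ : n₂ ≤ ω₂.density)
    {a b : ℝ} (ha : 0 ≤ a) (hb : 0 ≤ b) (hab : a + b = 1) {W Q₁ Q₂ : ℝ}
    (hW : W ≤ Ψ.varPressureAt β R (a * n₁ + b * n₂))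
    (hQ₁ : Ψ.varPressureAt β R n₁ ≤ Q₁) (hQ₂ : Ψ.varPressureAt β R n₂ ≤ Q₂)
    (hlt : a * Q₁ + b * Q₂ +
        β * |hz| * (min (a * n₁ + b * n₂) (2 - (a * n₁ + b * n₂)) + a * min n₁ (2 - n₁) + b * min n₂ (2 - n₂)) < W)
    {lam : ℝ} (hl0 : 0 < lam) (hl1 : lam < 1) :
    (InfVolFermionState.mix lam hl0.le hl1.le ω₁ ω₂).entropyDensitySup -
        β * (InfVolFermionState.mix lam hl0.le hl1.le ω₁ ω₂).meanEnergy
          (FermionInteraction.pencil Ψ (spinImbalanceInteraction d) (-hz)) R <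
      (FermionInteraction.pencil Ψ (spinImbalanceInteraction d) (-hz)).varPressureAt β R
        (InfVolFermionState.mix lam hl0.le hl1.le ω₁ ω₂).density := by
  obtain ⟨hmlo, hmhi⟩ := convexComb_mem_Icc'' ha hb hab hn12.le
  have real : ∀ ρ, n₁ ≤ ρ → ρ ≤ n₂ → ∃ ω : InfVolFermionState d, ω.IsTranslationInvariant ∧ ω.density = ρ :=
    fun ρ hlo hhi => exists_isTranslationInvariant_density_eq_of_mem_Icc h₁ h₂ ⟨hn₁.trans hlo, hhi.trans hn₂⟩
  have hW' := Ψ.varPressureAt_sub_field_le_pencil R hz hβ (real _ hmlo hmhi)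
  have hQ₁' := Ψ.varPressureAt_pencil_le_add_field R hz hβ (real n₁ le_rfl hn12.le)
  have hQ₂' := Ψ.varPressureAt_pencil_le_add_field R hz hβ (real n₂ hn12.le le_rfl)
  refine h₁.sub_mul_lt_varPressureAt_mix_of_caps_lt_floor_of_le hd β
    (FermionInteraction.pencil Ψ (spinImbalanceInteraction d) (-hz)) R h₂ hn₁ hn12 hn₂ ha hb hab
    (W := W - β * |hz| * min (a * n₁ + b * n₂) (2 - (a * n₁ + b * n₂))) (Q₁ := Q₁ + β * |hz| * min n₁ (2 - n₁))
    (Q₂ := Q₂ + β * |hz| * min n₂ (2 - n₂)) (by linarith) (by linarith) (by linarith) ?_ hl0 hl1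
  have e : a * (Q₁ + β * |hz| * min n₁ (2 - n₁)) + b * (Q₂ + β * |hz| * min n₂ (2 - n₂)) =
      a * Q₁ + b * Q₂ + β * |hz| * (a * min n₁ (2 - n₁) + b * min n₂ (2 - n₂)) := by ring
  rw [e]
  linarith

end InfVolFermionState

end Literature.MathematicalPhysics.QuantumLattice

end
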